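import Summits.Ventures.PercRepro.RankLevelSetRuleQSliceTailMono

/-!
# PercRepro — THE STEP INEQUALITY FOR ANY WEIGHTED SUM OF SLICE SUMS (night-1, gen 21; dossier §32.1)

The step identity `inner_succ` of RankLevelSetRuleQSliceTailMono holds for every inner sum
`G_R(m) = Σ_{a ≤ m} C(m, a)/C(m+K+R+a, a+R)` (every slice parameter `K` and every row index `R`). Here it is packaged for
ANY nonnegatively weighted sum over rows `R_j ≥ R₀`:
* **`weighted_inner_succ_le`** — `Σ_j w_j · G_{R_j}(m+1) ≤ f(R₀) · Σ_j w_j · G_{R_j}(m)` with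
  `f(R₀) = M(M+2R₀+2)/((M+R₀)(M+R₀+1))`, `M = m+K+1`, `w_j ≥ 0`;
* **`weighted_inner_succ_le_self`** — the sum is nonincreasing in `m` while `m + K + 1 ≤ R₀(R₀+1)`;
* **`sliceTail`**, **`sliceTail_succ_le`**, **`sliceTail_succ_le_self`** — the instance for the tail of the slice `u` of the family
  `k` (rows `k ≤ j ≤ u+k`, weights `C(u+k, j)`, `q = m + u`): `T_u(m+1) ≤ f(k)·T_u(m)`, and `T_u` decreases in `m` while
  `m + u + 1 ≤ k(k+1)` — the untruncated slices `u ≥ k − 1` read `R̂ − Φ = 1 + ρ(2q+k, q) − ρ(2m+u, m) − T_u` (dossier §32.1).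
Axioms: standard.
-/

namespace PercRepro

open Finset

/-- **The weighted step inequality**: for weights `w_j ≥ 0` and rows `R_j ≥ R₀`,
`Σ_j w_j · G_{R_j}(m+1) ≤ f(R₀) · Σ_j w_j · G_{R_j}(m)`, `f(R₀) = (m+K+1)(m+K+2R₀+3)/((m+K+R₀+1)(m+K+R₀+2))`. -/
theorem weighted_inner_succ_le (K R₀ m : ℕ) (J : Finset ℕ) (w : ℕ → ℚ) (hw : ∀ j ∈ J, 0 ≤ w j) (R : ℕ → ℕ)
    (hR : ∀ j ∈ J, R₀ ≤ R j) :
    ∑ j ∈ J, w j * ∑ a ∈ range (m + 1 + 1), ((m + 1).choose a : ℚ) / ((m + 1 + K + R j + a).choose (a + R j) : ℚ)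
      ≤ ((((m : ℚ) + K + 1) * ((m : ℚ) + K + 2 * R₀ + 3)) / (((m : ℚ) + K + R₀ + 1) * ((m : ℚ) + K + R₀ + 2)))
        * ∑ j ∈ J, w j * ∑ a ∈ range (m + 1), (m.choose a : ℚ) / ((m + K + R j + a).choose (a + R j) : ℚ) := by
  rw [Finset.mul_sum]
  apply Finset.sum_le_sum
  intro j hj
  rw [inner_succ K (R j) m, Finset.mul_sum, Finset.mul_sum, Finset.mul_sum]
  apply Finset.sum_le_sum
  intro a _
  have hM : (0 : ℚ) < (m : ℚ) + K + 1 := by positivity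
  have hRj : (R₀ : ℚ) ≤ (R j : ℚ) + a := by
    have : (R₀ : ℚ) ≤ R j := by exact_mod_cast hR j hj
    have : (0 : ℚ) ≤ a := by positivity
    linarith
  have hf := decay_factor_anti ((m : ℚ) + K + 1) (R₀ : ℚ) ((R j : ℚ) + a) hM (by positivity) hRj
  have hfac : (((m : ℚ) + K + 1) * ((m : ℚ) + K + 2 * (R j : ℚ) + 2 * a + 3))
        / ((((m : ℚ) + K + (R j : ℚ) + a + 1) * ((m : ℚ) + K + (R j : ℚ) + a + 2)))
      ≤ (((m : ℚ) + K + 1) * ((m : ℚ) + K + 2 * R₀ + 3)) / (((m : ℚ) + K + R₀ + 1) * ((m : ℚ) + K + R₀ + 2)) := by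
    convert hf using 2 <;> ring
  have hnn : (0 : ℚ) ≤ w j * ((m.choose a : ℚ) / ((m + K + R j + a).choose (a + R j) : ℚ)) :=
    mul_nonneg (hw j hj) (by positivity)
  calc w j * ((m.choose a : ℚ) / ((m + K + R j + a).choose (a + R j) : ℚ)
          * ((((m : ℚ) + K + 1) * ((m : ℚ) + K + 2 * (R j : ℚ) + 2 * a + 3))
              / ((((m : ℚ) + K + (R j : ℚ) + a + 1) * ((m : ℚ) + K + (R j : ℚ) + a + 2)))))
      = (w j * ((m.choose a : ℚ) / ((m + K + R j + a).choose (a + R j) : ℚ)))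
        * ((((m : ℚ) + K + 1) * ((m : ℚ) + K + 2 * (R j : ℚ) + 2 * a + 3))
              / ((((m : ℚ) + K + (R j : ℚ) + a + 1) * ((m : ℚ) + K + (R j : ℚ) + a + 2)))) := by ring
    _ ≤ (w j * ((m.choose a : ℚ) / ((m + K + R j + a).choose (a + R j) : ℚ)))
        * ((((m : ℚ) + K + 1) * ((m : ℚ) + K + 2 * R₀ + 3)) / (((m : ℚ) + K + R₀ + 1) * ((m : ℚ) + K + R₀ + 2))) :=
        mul_le_mul_of_nonneg_left hfac hnn
    _ = _ := by ring

/-- The weighted sums are nonnegative. -/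
lemma weighted_inner_nonneg (K m : ℕ) (J : Finset ℕ) (w : ℕ → ℚ) (hw : ∀ j ∈ J, 0 ≤ w j) (R : ℕ → ℕ) :
    0 ≤ ∑ j ∈ J, w j * ∑ a ∈ range (m + 1), (m.choose a : ℚ) / ((m + K + R j + a).choose (a + R j) : ℚ) := by
  apply Finset.sum_nonneg
  intro j hj
  apply mul_nonneg (hw j hj)
  apply Finset.sum_nonneg
  intro a _
  positivity

/-- **The weighted sum is nonincreasing in `m`** while `m + K + 1 ≤ R₀(R₀+1)` (the factor `f(R₀)` is then at most `1`). -/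
theorem weighted_inner_succ_le_self (K R₀ m : ℕ) (J : Finset ℕ) (w : ℕ → ℚ) (hw : ∀ j ∈ J, 0 ≤ w j) (R : ℕ → ℕ)
    (hR : ∀ j ∈ J, R₀ ≤ R j) (h : m + K + 1 ≤ R₀ * (R₀ + 1)) :
    ∑ j ∈ J, w j * ∑ a ∈ range (m + 1 + 1), ((m + 1).choose a : ℚ) / ((m + 1 + K + R j + a).choose (a + R j) : ℚ)
      ≤ ∑ j ∈ J, w j * ∑ a ∈ range (m + 1), (m.choose a : ℚ) / ((m + K + R j + a).choose (a + R j) : ℚ) := by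
  have hf : (((m : ℚ) + K + 1) * ((m : ℚ) + K + 2 * R₀ + 3)) / (((m : ℚ) + K + R₀ + 1) * ((m : ℚ) + K + R₀ + 2)) ≤ 1 := by
    rw [div_le_one (by positivity)]
    have : (m : ℚ) + K + 1 ≤ (R₀ : ℚ) * ((R₀ : ℚ) + 1) := by exact_mod_cast h
    nlinarith
  calc _ ≤ _ := weighted_inner_succ_le K R₀ m J w hw R hR
    _ ≤ 1 * ∑ j ∈ J, w j * ∑ a ∈ range (m + 1), (m.choose a : ℚ) / ((m + K + R j + a).choose (a + R j) : ℚ) :=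
        mul_le_mul_of_nonneg_right hf (weighted_inner_nonneg K m J w hw R)
    _ = _ := one_mul _

/-- The tail of the slice `u` of the family `k` at `q = m + u`: `T_u(m) = Σ_{k ≤ j ≤ u+k} C(u+k, j) · Σ_{a ≤ m} C(m, a)/C(m+u+j+a, a+j)`
(on the untruncated slices `u ≥ k − 1`: `R̂(q, k, m) − Φ(q+k, q) = 1 + ρ(2q+k, q) − ρ(2m+u, m) − T_u(m)`). -/
def sliceTail (u k m : ℕ) : ℚ :=
  ∑ j ∈ Finset.Icc k (u + k), ((u + k).choose j : ℚ)
    * ∑ a ∈ range (m + 1), (m.choose a : ℚ) / ((m + u + j + a).choose (a + j) : ℚ)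

/-- **`T_u(m+1) ≤ f(k) · T_u(m)`** with `f(k) = (m+u+1)(m+u+2k+3)/((m+u+k+1)(m+u+k+2))`, for every `u`, `k`, `m`. -/
theorem sliceTail_succ_le (u k m : ℕ) :
    sliceTail u k (m + 1)
      ≤ ((((m : ℚ) + u + 1) * ((m : ℚ) + u + 2 * k + 3)) / (((m : ℚ) + u + k + 1) * ((m : ℚ) + u + k + 2)))
        * sliceTail u k m := by
  unfold sliceTail
  exact weighted_inner_succ_le u k m (Finset.Icc k (u + k)) (fun j => ((u + k).choose j : ℚ)) (fun j _ => by positivity)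
    (fun j => j) (fun j hj => (Finset.mem_Icc.1 hj).1)

/-- **`T_u` is nonincreasing in `m`** while `m + u + 1 ≤ k(k+1)`. -/
theorem sliceTail_succ_le_self (u k m : ℕ) (h : m + u + 1 ≤ k * (k + 1)) : sliceTail u k (m + 1) ≤ sliceTail u k m := by
  unfold sliceTail
  exact weighted_inner_succ_le_self u k m (Finset.Icc k (u + k)) (fun j => ((u + k).choose j : ℚ)) (fun j _ => by positivity)
    (fun j => j) (fun j hj => (Finset.mem_Icc.1 hj).1) h

/-- The borderline tail is the instance `u = K` of `sliceTail` for the family `k = K + 2`: `borderTail m K = sliceTail K (K+2) m`. -/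
theorem borderTail_eq_sliceTail (m K : ℕ) : borderTail m K = sliceTail K (K + 2) m := by
  unfold borderTail sliceTail
  have h : Finset.Icc (K + 2) (K + (K + 2)) = Finset.Ico (K + 2) (2 * K + 2 + 1) := by
    ext j; simp only [Finset.mem_Icc, Finset.mem_Ico]; omega
  rw [h, Finset.sum_Ico_eq_sum_range, show 2 * K + 2 + 1 - (K + 2) = K + 1 by omega, show K + (K + 2) = 2 * K + 2 by ring]

end PercRepro
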